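import Mathlib
import Summits.KontsevichZagierPeriods.KontsevichZagierPeriods.Theses.HermiteRigidity
import Literature.NumberTheory.Transcendental.KZRelationsLE
import Literature.NumberTheory.Transcendental.KZLogCalculusProofs

/-!
# Sketch (ideator 3, round 1) for crux `EllipticMomentKernel` (stmt-KontsevichZagierPeriods-10631)

First lemmas of the two idea cards, stated over existing declarations only.  Nothing here is a
route item; the crux itself is `HermiteRigidity.EllipticMomentKernel` and is not restated.

* Card `one-interval-linearisation`: `DoubleHermiteDecomposition` (pure algebra in `ℚ[X]`),
  `ExactOnSigma` (the single move schema), `SigmaCarriesGenerators` (vertical collapse),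
  `LinearisedKernel` (the kernel statement on the image of `Φ_σ`).
* Card `oval-over-the-y-axis`: `OvalShadow` (quantifier-free shadow of `D` on the `y`-axis),
  `HalfOvalPushforward` (rule 2 along `√f` on the increasing half-oval),
  `HorizontalWidth` (the region `D` read over the `y`-axis: rule 2 swap + rule 3 with a
  POLYNOMIAL primitive), `PrimitiveFreeHermite` (Hermite exactness assembled from the two),
  `UpstairsHermite` (algebra: `ℚ[X] = ⟨f, Xf⟩ ⊕ T(ℚ[X])`, determinant `−Δ/105`), `LiftToD`
  (one-dimensional generators lifted to `D`), `UpstairsKernel` (rigidity on the normal forms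
  `[D, α + βx] + [σ, Q]`).
-/

namespace Summit.KontsevichZagierPeriods.KontsevichZagierPeriods.Cruxes.EllipticMomentKernel.SketchIdeator3

open Polynomial Set
open Literature.NumberTheory.Transcendental

noncomputable section

/-! ### Card A — one-interval linearisation -/

/-- The Weierstrass cubic as a polynomial over `ℚ`. -/
def wcubic (q₂ q₃ : ℚ) : ℚ[X] := C 4 * X ^ 3 - C q₂ * X - C q₃

/-- Hermite's operator `T P = P′ f + P f′/2` (so that `(P √f)′ = T P / √f`). -/
def hermiteT (q₂ q₃ : ℚ) (P : ℚ[X]) : ℚ[X] :=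
  derivative P * wcubic q₂ q₃ + P * derivative (wcubic q₂ q₃) * C (1 / 2 : ℚ)

/-- **First lemma of card A (pure algebra).**  The space of integrands
`𝓛 = ℚ[x]·1 ⊕ ℚ[x]·f^{-1/2}` on the oval splits as (4-dimensional normal forms) ⊕ (exact forms with
primitives vanishing at `e₃, e₂`): every `A ∈ ℚ[X]` is `γ + δ X + (f H)′` and every `B ∈ ℚ[X]` is
`α + β X + T P`.  Both operators `H ↦ (fH)′`, `P ↦ T P` are injective and raise the degree by
exactly `2` (leading coefficients `4(d+3)`, `4d+6`), so the statement is a dimension count in the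
degree filtration; no hypothesis on the discriminant is needed. -/
def DoubleHermiteDecomposition : Prop :=
  ∀ (q₂ q₃ : ℚ) (A B : ℚ[X]), ∃ (γ δ α β : ℚ) (H P : ℚ[X]),
    A = C γ + C δ * X + derivative (wcubic q₂ q₃ * H) ∧
    B = C α + C β * X + hermiteT q₂ q₃ P

/-- **The single move schema of card A.**  On the oval `σ = (e₃, e₂)` every exact integrand
`(fH)′ + (T P)/√f` (`H, P ∈ ℚ[X]`) is a relation: ONE Newton–Leibniz move in dimension `1 → 0`
with the `ℚ`-semialgebraic primitive `F = f·H + P·√f` on the closed band `[e₃, e₂]` over the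
point, whose boundary values both vanish, so the base representation is `[pt, 0]`, itself a
relation (`KZ.of_mem_relations_of_eqOn_zero`); closed band vs open `σ` is a null set
(`KZ.of_mem_relations_of_volume_eq_zero`).  Generalises support item `HermiteExactFormVanishes`
(the case `H = 0`). -/
def ExactOnSigma : Prop :=
  ∀ (q₂ q₃ : ℚ), 0 < (q₂ : ℝ) ^ 3 - 27 * (q₃ : ℝ) ^ 2 → ∀ (H P : ℚ[X]),
    let f : ℝ → ℝ := fun x => 4 * x ^ 3 - (q₂ : ℝ) * x - (q₃ : ℝ)
    let σ : Set (Fin 1 → ℝ) := {p | 0 < f (p 0) ∧ ∃ t : ℝ, p 0 < t ∧ f t < 0}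
    ∀ (r : KZ.IntegralRep 1), r.domain = σ →
      Set.EqOn r.integrand (fun p =>
        (aeval (p 0) (derivative (wcubic q₂ q₃ * H)) : ℝ) +
        (aeval (p 0) (hermiteT q₂ q₃ P) : ℝ) / Real.sqrt (f (p 0))) σ →
      KZ.of r ∈ KZ.relations

/-- **Vertical collapse (card A, the only two-dimensional step).**  Every generator of the crux's
set `S` is congruent modulo relations to ONE representation on `σ` with integrand
`A(x) + B(x)/√f(x)`, `A, B ∈ ℚ[X]`: a `2`-dimensional moment `[D, xᵃ yᵇ]` by one Newton–Leibniz move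
along `y` over the OPEN base `σ` (polynomial primitive `xᵃ y^{b+1}/(b+1)`, fibre bounds
`0 ≤ y ≤ √f(x)`), landing on `xᵃ f^{(b+1)/2}/(b+1)`, which on `σ` is `A` (`b` odd) or `B/√f` with
`B = xᵃ f^{b/2+1}/(b+1)` (`b` even); a `1`-dimensional generator is already of this shape. -/
def SigmaCarriesGenerators : Prop :=
  ∀ (q₂ q₃ : ℚ), 0 < (q₂ : ℝ) ^ 3 - 27 * (q₃ : ℝ) ^ 2 →
    let f : ℝ → ℝ := fun x => 4 * x ^ 3 - (q₂ : ℝ) * x - (q₃ : ℝ)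
    let σ : Set (Fin 1 → ℝ) := {p | 0 < f (p 0) ∧ ∃ t : ℝ, p 0 < t ∧ f t < 0}
    let D : Set (Fin 2 → ℝ) :=
      {p | (0 < f (p 0) ∧ ∃ t : ℝ, p 0 < t ∧ f t < 0) ∧ 0 < p 1 ∧ p 1 ^ 2 < f (p 0)}
    ∀ (r : KZ.IntegralRep 2) (a b : ℕ), r.domain = D →
      Set.EqOn r.integrand (fun p => p 0 ^ a * p 1 ^ b) D →
      ∃ (A B : ℚ[X]) (s : KZ.IntegralRep 1), s.domain = σ ∧
        Set.EqOn s.integrand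
          (fun p => (aeval (p 0) A : ℝ) + (aeval (p 0) B : ℝ) / Real.sqrt (f (p 0))) σ ∧
        KZ.of r - KZ.of s ∈ KZ.relations

/-- **The linearised kernel (card A's form of the crux on the image of `Φ_σ`).**  Under the
crux's inlined rigidity hypothesis, a single representation `[σ, A + B/√f]` of value `0` is a
relation.  Proof plan: `DoubleHermiteDecomposition` rewrites the integrand as
`(γ + δx) + (α + βx)/√f + exact`; `ExactOnSigma` removes the exact part (rule 1b); the value is
`γ(e₂−e₃) + δ(e₂²−e₃²)/2 + α J₀ + β J₁` with the first summand real-algebraic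
(`isAlgebraic_of_cubic_eq_zero`), so rigidity forces `α = β = 0` and
`γ(e₂−e₃) + δ(e₂²−e₃²)/2 = 0`, whence `[σ, γ + δx]` is one more Newton–Leibniz move onto
`[pt, 0]`.  Additivity of `Φ_σ : (A, B) ↦ [σ, A + B/√f]` modulo relations
(`KZ.integrandAddRel`) then carries the whole closure of `S`. -/
def LinearisedKernel : Prop :=
  ∀ (q₂ q₃ : ℚ), 0 < (q₂ : ℝ) ^ 3 - 27 * (q₃ : ℝ) ^ 2 →
    let f : ℝ → ℝ := fun x => 4 * x ^ 3 - (q₂ : ℝ) * x - (q₃ : ℝ)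
    let σ : Set (Fin 1 → ℝ) := {p | 0 < f (p 0) ∧ ∃ t : ℝ, p 0 < t ∧ f t < 0}
    (∀ a b c : ℝ, IsAlgebraic ℚ a → IsAlgebraic ℚ b → IsAlgebraic ℚ c →
      a + b * (∫ p in σ, 1 / Real.sqrt (f (p 0))) + c * (∫ p in σ, p 0 / Real.sqrt (f (p 0))) = 0 →
      a = 0 ∧ b = 0 ∧ c = 0) →
    ∀ (A B : ℚ[X]) (s : KZ.IntegralRep 1), s.domain = σ →
      Set.EqOn s.integrand
        (fun p => (aeval (p 0) A : ℝ) + (aeval (p 0) B : ℝ) / Real.sqrt (f (p 0))) σ →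
      s.value = 0 → KZ.of s ∈ KZ.relations


/-- Existence of the linearised representations `[σ, A + B/√f]` (semialgebraicity of `σ` by sign
conditions, of the integrand by `isSemialgebraicFunOn_aeval` / `.div` / `.sqrt_holds`,
integrability from that of `1/√f` on the oval). -/
def SigmaRepExists : Prop :=
  ∀ (q₂ q₃ : ℚ), 0 < (q₂ : ℝ) ^ 3 - 27 * (q₃ : ℝ) ^ 2 →
    let f : ℝ → ℝ := fun x => 4 * x ^ 3 - (q₂ : ℝ) * x - (q₃ : ℝ)
    let σ : Set (Fin 1 → ℝ) := {p | 0 < f (p 0) ∧ ∃ t : ℝ, p 0 < t ∧ f t < 0}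
    ∀ (A B : ℚ[X]), ∃ s : KZ.IntegralRep 1, s.domain = σ ∧
      Set.EqOn s.integrand
        (fun p => (aeval (p 0) A : ℝ) + (aeval (p 0) B : ℝ) / Real.sqrt (f (p 0))) σ

/-- **Glue of card A (PROVED): the crux BY NAME from the three statements.**  Closure induction
carries the invariant "`c ≡ Φ_σ(A, B)` modulo relations for some `A, B ∈ ℚ[X]`" (additivity of
`Φ_σ` is one instance of `KZ.integrandAddRel`, congruence of representations with equal data is
`KZ.of_sub_of_mem_relations_of_eqOn`); soundness transfers `eval c = 0` to the value of
`Φ_σ(A, B)`, and `LinearisedKernel` concludes. -/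
theorem ellipticMomentKernel_of (hE : SigmaRepExists) (hG : SigmaCarriesGenerators)
    (hK : LinearisedKernel) :
    Summit.KontsevichZagierPeriods.KontsevichZagierPeriods.Theses.HermiteRigidity.EllipticMomentKernel := by
  intro q₂ q₃ hΔ f σ hRIG D S c hc hval
  have key : ∀ c ∈ AddSubgroup.closure S, ∃ (A B : ℚ[X]), ∀ s : KZ.IntegralRep 1, s.domain = σ →
      Set.EqOn s.integrand
        (fun p => (aeval (p 0) A : ℝ) + (aeval (p 0) B : ℝ) / Real.sqrt (f (p 0))) σ →
      c - KZ.of s ∈ KZ.relations := by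
    intro c hc
    induction hc using AddSubgroup.closure_induction with
    | mem x hx =>
      rcases hx with ⟨r, a, b, hrd, hri, rfl⟩ | ⟨r, m, hrd, hri, rfl⟩
      · obtain ⟨A, B, s₀, hs₀d, hs₀i, hrel⟩ := hG q₂ q₃ hΔ r a b hrd hri
        refine ⟨A, B, fun s hsd hsi => ?_⟩
        have h2 : KZ.of s₀ - KZ.of s ∈ KZ.relations :=
          KZ.of_sub_of_mem_relations_of_eqOn (by rw [hsd, hs₀d]) (by
            rw [hs₀d]; intro p hp; rw [hs₀i hp, hsi hp])
        have : KZ.of r - KZ.of s = (KZ.of r - KZ.of s₀) + (KZ.of s₀ - KZ.of s) := by abel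
        rw [this]
        exact add_mem hrel h2
      · refine ⟨0, X ^ m, fun s hsd hsi => ?_⟩
        exact KZ.of_sub_of_mem_relations_of_eqOn (by rw [hsd, hrd]) (by
          rw [hrd]; intro p hp; rw [hri hp, hsi hp]; simp)
    | zero =>
      refine ⟨0, 0, fun s hsd hsi => ?_⟩
      rw [zero_sub]
      exact neg_mem (KZ.of_mem_relations_of_eqOn_zero s (by
        rw [hsd]; intro p hp; rw [hsi hp]; simp))
    | add x y hx hy ihx ihy =>
      obtain ⟨A₁, B₁, h₁⟩ := ihx
      obtain ⟨A₂, B₂, h₂⟩ := ihy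
      refine ⟨A₁ + A₂, B₁ + B₂, fun s hsd hsi => ?_⟩
      obtain ⟨s₁, hs₁d, hs₁i⟩ := hE q₂ q₃ hΔ A₁ B₁
      obtain ⟨s₂, hs₂d, hs₂i⟩ := hE q₂ q₃ hΔ A₂ B₂
      have hadd : KZ.of s - KZ.of s₁ - KZ.of s₂ ∈ KZ.relations :=
        KZ.integrandAddRel_subset_relations ⟨1, s, s₁, s₂, by rw [hs₁d, hsd], by rw [hs₂d, hsd], by
          rw [hsd]; intro p hp
          simp only [Pi.add_apply]
          rw [hsi hp, hs₁i hp, hs₂i hp]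
          simp only [map_add]
          ring, rfl⟩
      have : x + y - KZ.of s
          = (x - KZ.of s₁) + (y - KZ.of s₂) - (KZ.of s - KZ.of s₁ - KZ.of s₂) := by abel
      rw [this]
      exact sub_mem (add_mem (h₁ s₁ hs₁d hs₁i) (h₂ s₂ hs₂d hs₂i)) hadd
    | neg x hx ih =>
      obtain ⟨A, B, h⟩ := ih
      refine ⟨-A, -B, fun s hsd hsi => ?_⟩
      obtain ⟨s₀, hs₀d, hs₀i⟩ := hE q₂ q₃ hΔ A B
      have hneg : KZ.of s₀ + KZ.of s ∈ KZ.relations :=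
        KZ.of_add_of_mem_relations_of_eqOn_neg (by rw [hsd, hs₀d]) (by
          rw [hs₀d]; intro p hp
          simp only [Pi.neg_apply]
          rw [hsi hp, hs₀i hp]
          simp only [map_neg]
          ring)
      have : -x - KZ.of s = -(x - KZ.of s₀) - (KZ.of s₀ + KZ.of s) := by abel
      rw [this]
      exact sub_mem (neg_mem (h s₀ hs₀d hs₀i)) hneg
  obtain ⟨A, B, hAB⟩ := key c hc
  obtain ⟨s, hsd, hsi⟩ := hE q₂ q₃ hΔ A B
  have hrel := hAB s hsd hsi
  have hval_s : s.value = 0 := by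
    have h0 : KZ.eval (c - KZ.of s) = 0 :=
      (AddMonoidHom.mem_ker).1 (KZ.relations_le_ker_eval_holds hrel)
    rw [map_sub, KZ.eval_of, hval] at h0
    linarith
  have hs : KZ.of s ∈ KZ.relations := hK q₂ q₃ hΔ hRIG A B s hsd hsi hval_s
  have : c = (c - KZ.of s) + KZ.of s := by abel
  rw [this]
  exact add_mem hrel hs

/-! ### Card B — the oval over the `y`-axis -/

/-- **First lemma of card B (real algebra, quantifier-free shadow).**  The projection of `D` to
the `y`-axis is the interval `τ = (0, y_max)`, and it is cut out WITHOUT quantifiers by the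
discriminant of the pencil `f(x) − y²`: `y² < max_σ f` iff `4x³ − q₂x − (q₃ + y²)` has three real
roots iff `q₂³ > 27 (q₃ + y²)²`.  (So `τ`, like `σ = {f > 0} ∩ ({x < 0} ∪ {12x² < q₂})` and the
two half-ovals, is `ℚ`-semialgebraic by inspection — no Tarski–Seidenberg.) -/
def OvalShadow : Prop :=
  ∀ (q₂ q₃ : ℚ), 0 < (q₂ : ℝ) ^ 3 - 27 * (q₃ : ℝ) ^ 2 →
    let f : ℝ → ℝ := fun x => 4 * x ^ 3 - (q₂ : ℝ) * x - (q₃ : ℝ)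
    ∀ y : ℝ, (∃ x : ℝ, (0 < f x ∧ ∃ t : ℝ, x < t ∧ f t < 0) ∧ 0 < y ∧ y ^ 2 < f x) ↔
      (0 < y ∧ 27 * ((q₃ : ℝ) + y ^ 2) ^ 2 < (q₂ : ℝ) ^ 3)

/-- **Rule 2 along `Φ = √f` on the increasing half-oval (card B).**  On
`σl = (e₃, x*)`, `x* = −√(q₂/12)` (where `f′ = 12x² − q₂ > 0`), the map `x ↦ √f(x)` is an injective
`ℚ`-semialgebraic map onto `τ` with derivative `f′/(2√f) > 0` inside, so
`[σl, P · f′/(2√f)] − [τ, P ∘ ε₃]` is ONE change-of-variables move, `ε₃ = (√f|σl)⁻¹` (the small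
root of the pencil).  On the decreasing half `(x*, e₂)` the same with `|Φ′| = −f′/(2√f)` gives
`[σr, P · f′/(2√f)] − [τ, −P ∘ ε₂]`.  Shape = `stub_pushforwardDimOne` of the sibling crux
`GenusTwoCycleTransfer` (Theorems/HermiteRigidityGenusTwoCycleTransferPushforwardDimOne.lean). -/
def HalfOvalPushforward : Prop :=
  ∀ (q₂ q₃ : ℚ), 0 < (q₂ : ℝ) ^ 3 - 27 * (q₃ : ℝ) ^ 2 → ∀ (P : ℚ[X]),
    let f : ℝ → ℝ := fun x => 4 * x ^ 3 - (q₂ : ℝ) * x - (q₃ : ℝ)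
    let σl : Set (Fin 1 → ℝ) := {p | 0 < f (p 0) ∧ p 0 < 0 ∧ (q₂ : ℝ) < 12 * (p 0) ^ 2}
    let τ : Set (Fin 1 → ℝ) := {p | 0 < p 0 ∧ 27 * ((q₃ : ℝ) + (p 0) ^ 2) ^ 2 < (q₂ : ℝ) ^ 3}
    ∀ (r s : KZ.IntegralRep 1), r.domain = σl →
      Set.EqOn r.integrand
        (fun p => (aeval (p 0) P : ℝ) * (12 * (p 0) ^ 2 - (q₂ : ℝ)) / (2 * Real.sqrt (f (p 0)))) σl →
      s.domain = τ →
      (∀ p ∈ σl, s.integrand (fun _ => Real.sqrt (f (p 0))) = (aeval (p 0) P : ℝ)) →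
      KZ.of r - KZ.of s ∈ KZ.changeOfVariablesRel

/-- **`D` read over the `y`-axis (card B, the only Newton–Leibniz move, with a POLYNOMIAL
primitive).**  By unimodality of `f` on `σ` every horizontal slice of `D` at height `y ∈ τ` is the
interval `(ε₃ y, ε₂ y)` between the two roots of the pencil `f − y²` inside `[e₃, e₂]`, which stay
strictly inside `{f > 0}`; after the coordinate swap (rule 2 with a permutation matrix,
`KZ.of_sub_of_mem_relations_perm`) Newton–Leibniz along `x` with primitive `P(x)` gives
`[D, P′(x)] ≡ [τ, P(ε₂ y) − P(ε₃ y)]`.  The roots are characterised by sign conditions only. -/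
def HorizontalWidth : Prop :=
  ∀ (q₂ q₃ : ℚ), 0 < (q₂ : ℝ) ^ 3 - 27 * (q₃ : ℝ) ^ 2 → ∀ (P : ℚ[X]) (ε₃ ε₂ : ℝ → ℝ),
    let f : ℝ → ℝ := fun x => 4 * x ^ 3 - (q₂ : ℝ) * x - (q₃ : ℝ)
    let τ : Set (Fin 1 → ℝ) := {p | 0 < p 0 ∧ 27 * ((q₃ : ℝ) + (p 0) ^ 2) ^ 2 < (q₂ : ℝ) ^ 3}
    let D : Set (Fin 2 → ℝ) :=
      {p | (0 < f (p 0) ∧ ∃ t : ℝ, p 0 < t ∧ f t < 0) ∧ 0 < p 1 ∧ p 1 ^ 2 < f (p 0)}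
    (∀ p ∈ τ, f (ε₃ (p 0)) = (p 0) ^ 2 ∧ ε₃ (p 0) < 0 ∧ (q₂ : ℝ) < 12 * ε₃ (p 0) ^ 2) →
    (∀ p ∈ τ, f (ε₂ (p 0)) = (p 0) ^ 2 ∧ 12 * ε₂ (p 0) ^ 2 < (q₂ : ℝ)) →
    ∀ (r : KZ.IntegralRep 2) (s : KZ.IntegralRep 1), r.domain = D →
      Set.EqOn r.integrand (fun p => (aeval (p 0) (derivative P) : ℝ)) D →
      s.domain = τ →
      Set.EqOn s.integrand (fun p => (aeval (ε₂ (p 0)) P : ℝ) - (aeval (ε₃ (p 0)) P : ℝ)) τ →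
      KZ.of r - KZ.of s ∈ KZ.relations

/-- **Primitive-free Hermite exactness (card B's replacement for `HermiteExactFormVanishes`).**
`T P/√f = P′ √f + P f′/(2√f)`; the first summand lifts to `[D, P′]` by Newton–Leibniz along `y`
over the open base `σ` (polynomial primitive `P′(x)·y`) and then equals `[τ, P∘ε₂ − P∘ε₃]` by
`HorizontalWidth`; the second equals `[τ, P∘ε₃] + [τ, −P∘ε₂]` by `HalfOvalPushforward` on the two
halves (rule 1a at the algebraic point `x*`); the sum is `[τ, 0]`, a relation.  No primitive of
the chain is non-polynomial and no closed fibre passes through a branch point `(eᵢ, 0)`. -/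
def PrimitiveFreeHermite : Prop :=
  ∀ (q₂ q₃ : ℚ), 0 < (q₂ : ℝ) ^ 3 - 27 * (q₃ : ℝ) ^ 2 → ∀ (P : ℚ[X]),
    let f : ℝ → ℝ := fun x => 4 * x ^ 3 - (q₂ : ℝ) * x - (q₃ : ℝ)
    let σ : Set (Fin 1 → ℝ) := {p | 0 < f (p 0) ∧ ∃ t : ℝ, p 0 < t ∧ f t < 0}
    ∀ (r : KZ.IntegralRep 1), r.domain = σ →
      Set.EqOn r.integrand (fun p => (aeval (p 0) (hermiteT q₂ q₃ P) : ℝ) / Real.sqrt (f (p 0))) σ →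
      KZ.of r ∈ KZ.relationsLE 2


/-- **Upstairs Hermite (card B's algebraic lemma; here Δ ≠ 0 IS used).**  Modulo `T(ℚ[X])` the
classes of `f` and `X·f` form a basis of the 2-dimensional quotient `ℚ[X]/T(ℚ[X]) = ⟨1, X⟩`:
`f ≡ −(2q₂/5)X − 3q₃/5`, `Xf ≡ −(3q₃/7)X − q₂²/42`, determinant `−Δ/105`.  Hence every
`Q ∈ ℚ[X]` is `(α + βX)·f + T P`; read on `D` this says `[D, Q/f] ≡ [D, α + βX]` and
`[D, R(x)] ≡ [D, α' + β'X]` (take `Q = R f`): the transcendental normal forms are the AREA and the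
FIRST MOMENT of `D`, two representations of Kontsevich–Zagier's literal (rational) shape. -/
def UpstairsHermite : Prop :=
  ∀ (q₂ q₃ : ℚ), q₂ ^ 3 - 27 * q₃ ^ 2 ≠ 0 → ∀ (Q : ℚ[X]), ∃ (α β : ℚ) (P : ℚ[X]),
    Q = (C α + C β * X) * wcubic q₂ q₃ + hermiteT q₂ q₃ P

/-- **Lift of a one-dimensional generator to `D` (card B).**  `[σ, xᵐ/√f] ≡ [D, xᵐ/f(x)]`: one
Newton–Leibniz move along `y` over the open base `σ` with the primitive `xᵐ·y/f(x)` (rational,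
smooth on every closed fibre `[0, √f(x)]`, `x ∈ σ`, since `f(x) > 0` there); integrability of
`xᵐ/f` on `D` is INHERITED from the given generator by Tonelli (`∫∫_D |xᵐ|/f = ∫_σ |xᵐ|/√f`). -/
def LiftToD : Prop :=
  ∀ (q₂ q₃ : ℚ), 0 < (q₂ : ℝ) ^ 3 - 27 * (q₃ : ℝ) ^ 2 →
    let f : ℝ → ℝ := fun x => 4 * x ^ 3 - (q₂ : ℝ) * x - (q₃ : ℝ)
    let σ : Set (Fin 1 → ℝ) := {p | 0 < f (p 0) ∧ ∃ t : ℝ, p 0 < t ∧ f t < 0}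
    let D : Set (Fin 2 → ℝ) :=
      {p | (0 < f (p 0) ∧ ∃ t : ℝ, p 0 < t ∧ f t < 0) ∧ 0 < p 1 ∧ p 1 ^ 2 < f (p 0)}
    ∀ (r : KZ.IntegralRep 1) (m : ℕ), r.domain = σ →
      Set.EqOn r.integrand (fun p => p 0 ^ m / Real.sqrt (f (p 0))) σ →
      ∃ s : KZ.IntegralRep 2, s.domain = D ∧
        Set.EqOn s.integrand (fun p => p 0 ^ m / f (p 0)) D ∧ KZ.of r - KZ.of s ∈ KZ.relations

/-- **Upstairs kernel (card B's form of the last step).**  Under the inlined rigidity hypothesis,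
a combination `[D, α + βx] + [σ, Q]` (`α, β ∈ ℚ`, `Q ∈ ℚ[X]`) of value `0` is a relation: its value
is `αA₀ + βA₁ + ∫_σ Q` with `A₀ = −(3q₃/5)J₀ − (2q₂/5)J₁`, `A₁ = −(q₂²/42)J₀ − (3q₃/7)J₁`
(`UpstairsHermite` + soundness) and `∫_σ Q ∈ ℚ(e₂, e₃)`; rigidity and `det = −Δ/105 ≠ 0` force
`α = β = 0` and `∫_σ Q = 0`, and then `[σ, Q]` is one polynomial Newton–Leibniz move onto `[pt, 0]`,
`[D, 0]` a zero representation. -/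
def UpstairsKernel : Prop :=
  ∀ (q₂ q₃ : ℚ), 0 < (q₂ : ℝ) ^ 3 - 27 * (q₃ : ℝ) ^ 2 →
    let f : ℝ → ℝ := fun x => 4 * x ^ 3 - (q₂ : ℝ) * x - (q₃ : ℝ)
    let σ : Set (Fin 1 → ℝ) := {p | 0 < f (p 0) ∧ ∃ t : ℝ, p 0 < t ∧ f t < 0}
    (∀ a b c : ℝ, IsAlgebraic ℚ a → IsAlgebraic ℚ b → IsAlgebraic ℚ c →
      a + b * (∫ p in σ, 1 / Real.sqrt (f (p 0))) + c * (∫ p in σ, p 0 / Real.sqrt (f (p 0))) = 0 →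
      a = 0 ∧ b = 0 ∧ c = 0) →
    let D : Set (Fin 2 → ℝ) :=
      {p | (0 < f (p 0) ∧ ∃ t : ℝ, p 0 < t ∧ f t < 0) ∧ 0 < p 1 ∧ p 1 ^ 2 < f (p 0)}
    ∀ (α β : ℚ) (Q : ℚ[X]) (s : KZ.IntegralRep 2) (t : KZ.IntegralRep 1),
      s.domain = D → Set.EqOn s.integrand (fun p => (α : ℝ) + (β : ℝ) * p 0) D →
      t.domain = σ → Set.EqOn t.integrand (fun p => (aeval (p 0) Q : ℝ)) σ →
      s.value + t.value = 0 → KZ.of s + KZ.of t ∈ KZ.relations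

/-- Sanity: card B's conclusion is at least as strong as the support item it replaces
(`relationsLE 2 ≤ relations`). -/
theorem primitiveFreeHermite_le (h : PrimitiveFreeHermite) :
    ∀ (q₂ q₃ : ℚ), 0 < (q₂ : ℝ) ^ 3 - 27 * (q₃ : ℝ) ^ 2 → ∀ (P : ℚ[X]),
    let f : ℝ → ℝ := fun x => 4 * x ^ 3 - (q₂ : ℝ) * x - (q₃ : ℝ)
    let σ : Set (Fin 1 → ℝ) := {p | 0 < f (p 0) ∧ ∃ t : ℝ, p 0 < t ∧ f t < 0}
    ∀ (r : KZ.IntegralRep 1), r.domain = σ →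
      Set.EqOn r.integrand (fun p => (aeval (p 0) (hermiteT q₂ q₃ P) : ℝ) / Real.sqrt (f (p 0))) σ →
      KZ.of r ∈ KZ.relations := by
  intro q₂ q₃ hΔ P f σ r hr hint
  exact KZ.relationsLE_le_relations (d := 2) (h q₂ q₃ hΔ P r hr hint)

end

end Summit.KontsevichZagierPeriods.KontsevichZagierPeriods.Cruxes.EllipticMomentKernel.SketchIdeator3
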